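import Literature.NumberTheory.NumberFields.SqrtTwoTowerTwoGaloisAction
import Literature.NumberTheory.NumberFields.SqrtTwoTowerThreeGaloisAction
import Literature.NumberTheory.IwasawaTheory.ClassGroupLayerTwoOrderFourOfTowerCertificate
import Literature.NumberTheory.IwasawaTheory.ClassGroupPRankLeOfRelationTwoAnyDepth
import HarnessLib

/-!
# `μ₂ = 0`, `λ₂ ≤ 2` FROM A RELATION ROW AT LAYER TWO: the t-free relation door of the cyclotomic `ℤ₂`-tower fed by COORDINATES in the degree-`4[K:ℚ]` layer
# `K_2 = K·ℚ(ζ₁₆)⁺` — the class `c = [(q₀², s₂ − t)]`, the generator `σ : s₂ ↦ s₂³ − 3s₂` of `Gal(K_2/K)`, and ONE principal generator `y` of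
# `(1 + σ)²·𝔠 = 𝔠·(σ𝔠)²·σ²𝔠 = (q₀², (t² − 2 − s₁)·(σs₂ − t)²)` certified by its norm

`Proofs`-style file (theorems only: no definition, no named fact, no instance, no `sorry`) in topic `NumberTheory/IwasawaTheory` (namespace = path),
written by the prover seat `bsd-line-att-p4` g43 (cell `bsd-f1-sign2`, route `AlignedTransportAtTwo`; `--supports` stmt-BirchSwinnertonDyer-22298, closes nothing).
Layer-TWO sibling of this seat's `ClassicalMuVanishesLayerThreeRelationCertificateTwo`: the consumer of att-p3 g49's relation door
`classicalMuVanishes_two_of_relation_of_genusCert_layer_anyDepth` at `m = 2` with the relation shape `f = (1 + X)² = (X − 1)² + 2·(2X)` (`d = 2 ≤ 2² − 2`),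
the shape of the cell's CONVERSE QUADRANT (`t ≥ 4 ∧ e₁ ≥ 2`: a cyclic `Λ`-module `X` with `#X/(T+2)X = 4` is killed by `(T + 2)²` at layer two).

* ★★★ `classicalMuVanishes_two_of_relationCert_layer_two` — `K` odd degree, `2 ∤ d_K`, `κ` cyclotomic, two dyadic primes, `2 ∤ h_K`, `𝓞_K/𝔭₁ = 𝔽₂`, units
  `≡ ±1 (mod 𝔭₁³)`; DATA in `𝓞_K` (coordinates on `1, s₁, s₂, s₁s₂`): `q₀` with `(q₀)` maximal and `q₀ ≡ ±3 (mod 𝔭₁³)`; `t ∈ ℤ`; a residue map `ψ : 𝓞_K → ℤ/q`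
  (`q > 1`, `2` invertible) with `ψ(q₀) = 0`, `P₂(t) = (t²−2)²−2 = 0`; Bézout data `α q₀⁸ + β P₂(t) = q₀`, `α₁q₀² + 2t·v₁ = 1`; the SQUARE witness
  `x q₀⁴ + q₀²·(e⋆w) + z⋆w² = q₀²` (`w = s₁s₂ − s₂ − t = σs₂ − t`); the comaximality witness `a q₀² + c⋆(t²−2−s₁) + d⋆w² = 1`; an element `y` with
  `y = λq₀² + μ⋆((t²−2−s₁)w²)` and `N_{K_2/K}(y) = ε q₀⁴` ⟹ **`rank₂ Cl(K_l) ≤ 2 ∀ l`, `μ₂(κ) = 0`, `λ₂(κ) ≤ 2`**.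

WHY IT IS A PROOF.  `J = (q₀², s₂ − t)` is proper (residue symbol) with `N_{K_2/K}(J) ⊇ (q₀⁸, P₂(t)) ∋ q₀`, so `N(J) = (q₀)`; `J·σ²J = (q₀², t² − 2 − s₁)`
(`σ²s₂ = −s₂`), `(σJ)² = (q₀², (σs₂ − t)²)` (the square witness), product `A = (q₀², (t²−2−s₁)(σs₂−t)²)` (comaximality); `y ∈ A` and `N((y)) = N(A) = (q₀)⁴`
force `(y) = A` (Dedekind cancellation); then att-p3's door with `𝔄 = N_{K_2/K_1}J`, `k = 1`, `π = q₀`.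

CELL READING (crux C2): first customers `N = 4307` (`q₀ = −11 + 3θ`, `t = 42`, `y` one-digit) and `N = 13971` — the CONVERSE QUADRANT, where no door of the tree
fired before (att-p3 g45/g49 census).  HONEST SCOPE: classical; nothing about any summit is asserted here; BSD is not advanced.

References: [Washington1997] §13.1, §13.3 Prop. 13.22–13.23; [Lang1990] Ch. 13 §4 Lemma 4.1; [Fukuda1994] Thm. 1; [Gras2003] IV.4; [NeukirchANT1999] Ch. I §2,
§3 (3.3), §8, Ch. III (1.6)–(1.7); [Cohen1993] §4.7, §6.5.
-/

set_option autoImplicit false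

noncomputable section

open scoped NumberField nonZeroDivisors
open NumberField IsDedekindDomain Module Polynomial Finset

namespace Literature.NumberTheory.IwasawaTheory

open Literature.NumberTheory.EllipticCurves Literature.NumberTheory.NumberFields Literature.NumberTheory.NumberFields.AmbiguousClass

variable {K : Type} [Field K] [NumberField K]

set_option maxHeartbeats 3200000 in
set_option synthInstance.maxHeartbeats 400000 in
/-- ★★★ **`μ₂ = 0`, `λ₂ ≤ 2`, `rank₂ Cl(K_l) ≤ 2 ∀ l` FROM A LAYER-TWO RELATION ROW `(1+σ)²𝔠 = (y)` IN COORDINATES** (hypotheses as in the module docstring).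
[cite: Washington1997, §13.3 Prop. 13.22–13.23] [cite: Lang1990, Ch. 13 §4 Lemma 4.1] [cite: NeukirchANT1999, Ch. III (1.6)–(1.7); Ch. I §3 (3.3)]
[cite: Cohen1993, §4.7, §6.5] -/
theorem classicalMuVanishes_two_of_relationCert_layer_two (hK2 : ¬ 2 ∣ Module.finrank ℚ K) (hd : ¬ (2 : ℤ) ∣ NumberField.discr K)
    (κ : ZpExtension K 2) (hκ : κ.IsCyclotomic)
    (h2card : {w : HeightOneSpectrum (𝓞 K) | ((2 : ℕ) : 𝓞 K) ∈ w.asIdeal}.ncard = 2)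
    (hh : ¬ 2 ∣ classNumber K)
    (P : Ideal (𝓞 K)) [P.IsMaximal] (hres : ∀ r : 𝓞 K, r ∈ P ∨ r - 1 ∈ P) (h2P : (2 : 𝓞 K) ∈ P)
    (hunits : ∀ u : (𝓞 K)ˣ, (u : 𝓞 K) - 1 ∈ P ^ 3 ∨ (u : 𝓞 K) + 1 ∈ P ^ 3)
    (q₀ : 𝓞 K) (hq₀ : (Ideal.span {q₀}).IsMaximal) (hπ : q₀ - 3 ∈ P ^ 3 ∨ q₀ + 3 ∈ P ^ 3)
    (t : ℤ) {q : ℕ} (hq : 1 < q) (ψ : 𝓞 K →+* ZMod q) (hψ : ψ q₀ = 0) {ti : ZMod q} (hti : 2 * ti = 1)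
    (hPt : ((t : ZMod q) ^ 2 - 2) ^ 2 - 2 = 0)
    (α β : 𝓞 K) (hBez : α * q₀ ^ 8 + β * (((t : 𝓞 K) ^ 2 - 2) ^ 2 - 2) = q₀)
    (α₁ v₁ : 𝓞 K) (hC1 : α₁ * q₀ ^ 2 + v₁ * (2 * (t : 𝓞 K)) = 1)
    (x₀ x₁ x₂ x₃ e₀ e₁ e₂ e₃ z₀ z₁ z₂ z₃ : 𝓞 K)
    (hsq₀ : x₀ * q₀ ^ 4 + q₀ ^ 2 * (2 * e₃ - (t : 𝓞 K) * e₀) + (2 * z₀ - 2 * z₁ - 4 * (t : 𝓞 K) * z₃ + (t : 𝓞 K) ^ 2 * z₀) = q₀ ^ 2)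
    (hsq₁ : x₁ * q₀ ^ 4 + q₀ ^ 2 * (e₂ - (t : 𝓞 K) * e₁) + (-z₀ + 2 * z₁ - 2 * (t : 𝓞 K) * z₂ + (t : 𝓞 K) ^ 2 * z₁) = 0)
    (hsq₂ : x₂ * q₀ ^ 4 + q₀ ^ 2 * (-e₀ + 2 * e₁ - (t : 𝓞 K) * e₂) + (2 * z₂ - 2 * z₃ + 2 * (t : 𝓞 K) * z₀ - 4 * (t : 𝓞 K) * z₁ + (t : 𝓞 K) ^ 2 * z₂) = 0)
    (hsq₃ : x₃ * q₀ ^ 4 + q₀ ^ 2 * (e₀ - e₁ - (t : 𝓞 K) * e₃) + (-z₂ + 2 * z₃ - 2 * (t : 𝓞 K) * z₀ + 2 * (t : 𝓞 K) * z₁ + (t : 𝓞 K) ^ 2 * z₃) = 0)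
    (a₀ a₁ a₂ a₃ c₀ c₁ c₂ c₃ d₀ d₁ d₂ d₃ : 𝓞 K)
    (hC2₀ : a₀ * q₀ ^ 2 + (-2 * c₀ - 2 * c₁ + (t : 𝓞 K) ^ 2 * c₀) + (2 * d₀ - 2 * d₁ - 4 * (t : 𝓞 K) * d₃ + (t : 𝓞 K) ^ 2 * d₀) = 1)
    (hC2₁ : a₁ * q₀ ^ 2 + (-c₀ - 2 * c₁ + (t : 𝓞 K) ^ 2 * c₁) + (-d₀ + 2 * d₁ - 2 * (t : 𝓞 K) * d₂ + (t : 𝓞 K) ^ 2 * d₁) = 0)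
    (hC2₂ : a₂ * q₀ ^ 2 + (-2 * c₂ - 2 * c₃ + (t : 𝓞 K) ^ 2 * c₂) + (2 * d₂ - 2 * d₃ + 2 * (t : 𝓞 K) * d₀ - 4 * (t : 𝓞 K) * d₁ + (t : 𝓞 K) ^ 2 * d₂) = 0)
    (hC2₃ : a₃ * q₀ ^ 2 + (-c₂ - 2 * c₃ + (t : 𝓞 K) ^ 2 * c₃) + (-d₂ + 2 * d₃ - 2 * (t : 𝓞 K) * d₀ + 2 * (t : 𝓞 K) * d₁ + (t : 𝓞 K) ^ 2 * d₃) = 0)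
    (y₀ y₁ y₂ y₃ l₀ l₁ l₂ l₃ m₀ m₁ m₂ m₃ : 𝓞 K)
    (hy₀ : y₀ = l₀ * q₀ ^ 2 + (-2 * m₀ + 4 * (t : 𝓞 K) * m₂ + 8 * (t : 𝓞 K) * m₃ - 4 * (t : 𝓞 K) ^ 2 * m₁ - 4 * (t : 𝓞 K) ^ 3 * m₃ + (t : 𝓞 K) ^ 4 * m₀))
    (hy₁ : y₁ = l₁ * q₀ ^ 2 + (-2 * m₁ + 4 * (t : 𝓞 K) * m₂ + 4 * (t : 𝓞 K) * m₃ - 2 * (t : 𝓞 K) ^ 2 * m₀ - 2 * (t : 𝓞 K) ^ 3 * m₂ + (t : 𝓞 K) ^ 4 * m₁))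
    (hy₂ : y₂ = l₂ * q₀ ^ 2 + (-2 * m₂ + 4 * (t : 𝓞 K) * m₁ - 4 * (t : 𝓞 K) ^ 2 * m₃ + 2 * (t : 𝓞 K) ^ 3 * m₀ - 4 * (t : 𝓞 K) ^ 3 * m₁ + (t : 𝓞 K) ^ 4 * m₂))
    (hy₃ : y₃ = l₃ * q₀ ^ 2 + (-2 * m₃ + 2 * (t : 𝓞 K) * m₀ - 2 * (t : 𝓞 K) ^ 2 * m₂ - 2 * (t : 𝓞 K) ^ 3 * m₀ + 2 * (t : 𝓞 K) ^ 3 * m₁ + (t : 𝓞 K) ^ 4 * m₃))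
    (ε : (𝓞 K)ˣ) (hN : (y₀ ^ 2 + 2 * y₁ ^ 2 - 2 * y₂ ^ 2 - 4 * y₃ ^ 2 - 4 * y₂ * y₃) ^ 2 - 2 * (2 * y₀ * y₁ - y₂ ^ 2 - 2 * y₃ ^ 2 - 4 * y₂ * y₃) ^ 2 = ε * q₀ ^ 4) :
    (∀ l, classGroupPRank κ l ≤ 2) ∧ ClassicalMuVanishes κ ∧ classicalLambda κ ≤ 2 := by
  classical
  haveI : Fact (Nat.Prime 2) := ⟨Nat.prime_two⟩
  -- ### the layers `K₁ ⊂ K₂`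
  have h12 : κ.layer 1 ≤ κ.layer 2 := κ.layer_mono one_le_two
  letI alg12 : Algebra (κ.layer 1) (κ.layer 2) := (IntermediateField.inclusion h12).toRingHom.toAlgebra
  haveI tow12 : IsScalarTower K (κ.layer 1) (κ.layer 2) :=
    IsScalarTower.of_algebraMap_eq fun x => ((IntermediateField.inclusion h12).commutes x).symm
  letI : Algebra (κ.layer 1) (κ.layer (1 + 1)) := alg12
  haveI : IsScalarTower K (κ.layer 1) (κ.layer (1 + 1)) := tow12
  haveI : FiniteDimensional K (κ.layer 1) := κ.finiteDimensional_layer_holds 1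
  haveI : FiniteDimensional K (κ.layer 2) := κ.finiteDimensional_layer_holds 2
  haveI : NumberField (κ.layer 1) := NumberField.of_module_finite K _
  haveI : NumberField (κ.layer 2) := NumberField.of_module_finite K _
  haveI : IsGalois K (κ.layer 1) := κ.isGalois_layer_holds 1
  haveI : IsGalois K (κ.layer 2) := κ.isGalois_layer_holds 2
  haveI : IsGalois (κ.layer 1) (κ.layer 2) := IsGalois.tower_top_of_isGalois K _ _
  haveI : FiniteDimensional (κ.layer 1) (κ.layer 2) := Module.Finite.of_restrictScalars_finite K _ _
  have hdeg1 : Module.finrank K (κ.layer 1) = 2 := by rw [κ.finrank_layer_holds 1, pow_one]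
  have hdeg2 : Module.finrank (κ.layer 1) (κ.layer 2) = 2 := finrank_layer_one_layer_two κ
  have hdeg4 : Module.finrank K (κ.layer 2) = 4 := by rw [κ.finrank_layer_holds 2]; norm_num
  -- ### generators `s₁ ∈ K₁`, `s₂ ∈ K₂` and integral copies `S₁, S₂ ∈ 𝓞 K₂`
  obtain ⟨s₁, hs₁, s₂', hs₂', hs₂K''⟩ := exists_sqrt_two_layer_one_sqrt_two_add_layer_two κ hK2 hκ
  set s₂ : κ.layer 2 := s₂' with hs₂def
  have hs₂ : s₂ ^ 2 = algebraMap (κ.layer 1) (κ.layer 2) (2 + s₁) := hs₂'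
  have hs₂K : ∀ x : κ.layer 1, algebraMap (κ.layer 1) (κ.layer 2) x ≠ s₂ := fun x hx => hs₂K'' ⟨x, hx⟩
  clear_value s₂
  clear hs₂' hs₂K'' hs₂def
  have hs₁K : ∀ x : K, algebraMap K (κ.layer 1) x ≠ s₁ := forall_algebraMap_ne_of_sq_eq_two hd hs₁
  have hs₁int : IsIntegral ℤ s₁ := by
    refine ⟨Polynomial.X ^ 2 - Polynomial.C 2, Polynomial.monic_X_pow_sub_C _ two_ne_zero, ?_⟩
    simp [hs₁]
  have h2int : IsIntegral ℤ (2 : κ.layer 2) := by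
    have := isIntegral_algebraMap (R := ℤ) (A := κ.layer 2) (x := (2 : ℤ))
    rwa [map_ofNat] at this
  have hs₂int : IsIntegral ℤ s₂ := by
    refine IsIntegral.of_pow (n := 2) (by norm_num) ?_
    rw [hs₂, map_add, map_ofNat]
    exact h2int.add (map_isIntegral_int _ hs₁int)
  obtain ⟨S₁, hS₁val⟩ : ∃ S : 𝓞 (κ.layer 2), algebraMap (𝓞 (κ.layer 2)) (κ.layer 2) S = algebraMap (κ.layer 1) (κ.layer 2) s₁ :=
    ⟨⟨_, map_isIntegral_int (algebraMap (κ.layer 1) (κ.layer 2)) hs₁int⟩, rfl⟩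
  obtain ⟨S₂, hS₂val⟩ : ∃ S : 𝓞 (κ.layer 2), algebraMap (𝓞 (κ.layer 2)) (κ.layer 2) S = s₂ := ⟨⟨_, hs₂int⟩, rfl⟩
  have hT₁ : (algebraMap (κ.layer 1) (κ.layer 2) s₁) ^ 2 = 2 := by rw [← map_pow, hs₁, map_ofNat]
  have hT₂ : s₂ ^ 2 = 2 + algebraMap (κ.layer 1) (κ.layer 2) s₁ := by rw [hs₂, map_add, map_ofNat]
  have hS₁ : S₁ ^ 2 = 2 := by
    apply RingOfIntegers.coe_injective
    rw [map_pow, map_ofNat, hS₁val]; exact hT₁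
  have hS₂ : S₂ ^ 2 = 2 + S₁ := by
    apply RingOfIntegers.coe_injective
    rw [map_pow, map_add, map_ofNat, hS₂val, hS₁val]; exact hT₂
  set f := algebraMap (𝓞 K) (𝓞 (κ.layer 2)) with hf
  have hcoe : ∀ z : 𝓞 K, algebraMap (𝓞 (κ.layer 2)) (κ.layer 2) (f z) = algebraMap K (κ.layer 2) (z : K) := fun z => by
    rw [hf]
    exact (IsScalarTower.algebraMap_apply (𝓞 K) (𝓞 (κ.layer 2)) (κ.layer 2) z).symm.trans
      (IsScalarTower.algebraMap_apply (𝓞 K) K (κ.layer 2) z)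
  have hia : ∀ (τ : (κ.layer 2) ≃ₐ[K] (κ.layer 2)) (x : 𝓞 (κ.layer 2)),
      algebraMap (𝓞 (κ.layer 2)) (κ.layer 2) ((intAut τ : 𝓞 (κ.layer 2) →+* 𝓞 (κ.layer 2)) x) = τ (algebraMap (𝓞 (κ.layer 2)) (κ.layer 2) x) :=
    fun τ x => rfl
  -- ### the generator `σ` of `Gal(K₂/K)` with `σ s₂ = s₂³ − 3 s₂`
  obtain ⟨σ, hσ⟩ := exists_algEquiv_apply_eq_tower2 (K := K) hdeg1 hdeg2 hs₁ hs₁K hs₂ hs₂K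
  have hgen : ∀ τ : (κ.layer 2) ≃ₐ[K] (κ.layer 2), τ ∈ Subgroup.zpowers σ :=
    forall_mem_zpowers_of_apply_eq_tower2 (K := K) hdeg1 hdeg2 hs₁ hs₁K hs₂ hσ
  obtain ⟨-, hσ1, hσ2, -⟩ := tower2_galois_iterates (K := K) hs₁ hs₂ hσ
  -- ### the ideal `J = (q₀², S₂ − t)` and its conjugates
  have hq₀0 : q₀ ≠ 0 := fun h0 => by
    rw [h0, Ideal.span_singleton_zero] at hq₀
    exact Ring.ne_bot_of_isMaximal_of_not_isField hq₀ (RingOfIntegers.not_isField K) rfl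
  obtain ⟨b, hb⟩ : ∃ b : 𝓞 (κ.layer 2), b = f (q₀ ^ 2) := ⟨_, rfl⟩
  have hbL : algebraMap (𝓞 (κ.layer 2)) (κ.layer 2) b = algebraMap K (κ.layer 2) ((q₀ : K) ^ 2) := by
    rw [hb, hcoe]; push_cast; rfl
  have hbf : b = f q₀ ^ 2 := by rw [hb, map_pow]
  have hb0 : b ≠ 0 := fun h => hq₀0 (by
    have h' : algebraMap (𝓞 (κ.layer 2)) (κ.layer 2) b = 0 := by rw [h, map_zero]
    rw [hbL, map_eq_zero_iff _ (algebraMap K (κ.layer 2)).injective] at h'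
    exact RingOfIntegers.coe_injective (by simpa using h'))
  have hI0 : Ideal.span {b, S₂ - (t : 𝓞 (κ.layer 2))} ≠ ⊥ := fun h => hb0 (by
    have : b ∈ Ideal.span {b, S₂ - (t : 𝓞 (κ.layer 2))} := Ideal.subset_span (by simp)
    rw [h, Ideal.mem_bot] at this
    exact this)
  have hmapI : ∀ (τ : (κ.layer 2) ≃ₐ[K] (κ.layer 2)) (Z : 𝓞 (κ.layer 2)), algebraMap (𝓞 (κ.layer 2)) (κ.layer 2) Z = τ s₂ - t →
      (Ideal.span {b, S₂ - (t : 𝓞 (κ.layer 2))}).map (intAut τ : 𝓞 (κ.layer 2) →+* 𝓞 (κ.layer 2)) = Ideal.span {b, Z} := by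
    intro τ Z hZ
    rw [Ideal.map_span, Set.image_pair]
    have h1 : (intAut τ : 𝓞 (κ.layer 2) →+* 𝓞 (κ.layer 2)) b = b := by
      apply RingOfIntegers.coe_injective
      rw [hia, hbL]
      exact τ.commutes _
    have h2 : (intAut τ : 𝓞 (κ.layer 2) →+* 𝓞 (κ.layer 2)) (S₂ - t) = Z := by
      apply RingOfIntegers.coe_injective
      rw [hia, hZ, map_sub, map_intCast, hS₂val, map_sub, map_intCast]
    rw [h1, h2]
  have hZ₀ : algebraMap (𝓞 (κ.layer 2)) (κ.layer 2) (S₂ - t) = (1 : (κ.layer 2) ≃ₐ[K] (κ.layer 2)) s₂ - t := by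
    rw [AlgEquiv.one_apply, map_sub, map_intCast, hS₂val]
  have hZ₁ : algebraMap (𝓞 (κ.layer 2)) (κ.layer 2) (S₁ * S₂ - S₂ - t) = σ s₂ - t := by
    rw [hσ1, map_sub, map_sub, map_mul, map_intCast, hS₂val, hS₁val]
  have hZ₂ : algebraMap (𝓞 (κ.layer 2)) (κ.layer 2) (-S₂ - t) = (σ ^ 2) s₂ - t := by
    rw [hσ2, map_sub, map_neg, map_intCast, hS₂val]
  -- ### two-generator calculus: `J·σ²J`, `(σJ)²`, and their product
  have hfC1 : f α₁ * b + (-f v₁) * (S₂ - t) + (-f v₁) * (-S₂ - t) = 1 := by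
    have h := congrArg f hC1
    simp only [map_add, map_mul, map_pow, map_one, map_intCast, map_ofNat] at h
    rw [hbf]; linear_combination h
  have hP02 : Ideal.span {b, S₂ - (t : 𝓞 (κ.layer 2))} * Ideal.span {b, -S₂ - (t : 𝓞 (κ.layer 2))} =
      Ideal.span {b, (t : 𝓞 (κ.layer 2)) ^ 2 - 2 - S₁} := by
    rw [span_pair_mul_span_pair_eq_of_comax hfC1]
    have : (S₂ - (t : 𝓞 (κ.layer 2))) * (-S₂ - (t : 𝓞 (κ.layer 2))) = (t : 𝓞 (κ.layer 2)) ^ 2 - 2 - S₁ := by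
      linear_combination (-1 : 𝓞 (κ.layer 2)) * hS₂
    rw [this]
  have hw2 : (S₁ * S₂ - S₂ - (t : 𝓞 (κ.layer 2))) ^ 2 = ((t : 𝓞 (κ.layer 2)) ^ 2 + 2) - S₁ + 2 * (t : 𝓞 (κ.layer 2)) * S₂ - 2 * (t : 𝓞 (κ.layer 2)) * (S₁ * S₂) := by
    linear_combination (3 + (-2) * S₁) * hS₂ + ((-2) + S₂ ^ 2) * hS₁
  have hsq : Ideal.span {b, S₁ * S₂ - S₂ - (t : 𝓞 (κ.layer 2))} ^ 2 =
      Ideal.span {b, ((t : 𝓞 (κ.layer 2)) ^ 2 + 2) - S₁ + 2 * (t : 𝓞 (κ.layer 2)) * S₂ - 2 * (t : 𝓞 (κ.layer 2)) * (S₁ * S₂)} := by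
    rw [← hw2]
    apply span_pair_sq_eq_span_pair_sq_of_eq (x := f x₀ + f x₁ * S₁ + (f x₂ + f x₃ * S₁) * S₂) (e := f e₀ + f e₁ * S₁ + (f e₂ + f e₃ * S₁) * S₂)
      (z := f z₀ + f z₁ * S₁ + (f z₂ + f z₃ * S₁) * S₂)
    have g₀ := congrArg f hsq₀
    have g₁ := congrArg f hsq₁
    have g₂ := congrArg f hsq₂
    have g₃ := congrArg f hsq₃
    simp only [map_add, map_sub, map_mul, map_neg, map_pow, map_intCast, map_ofNat, map_zero] at g₀ g₁ g₂ g₃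
    rw [hbf]
    linear_combination g₀ + S₁ * g₁ + S₂ * g₂ + S₁ * S₂ * g₃
      + (3 * f z₀ + (-4) * f z₁ + (-1) * (f q₀ ^ 2) * f e₂ + 2 * (f q₀ ^ 2) * f e₃ + (-2) * S₁ * f z₀ + 3 * S₁ * f z₁ + 3 * S₂ * f z₂ + (-4) * S₂ * f z₃
          + 2 * (t : 𝓞 (κ.layer 2)) * f z₂ + (-4) * (t : 𝓞 (κ.layer 2)) * f z₃ + (f q₀ ^ 2) * S₁ * f e₂ + (-1) * (f q₀ ^ 2) * S₁ * f e₃ + (-2) * S₁ * S₂ * f z₂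
          + 3 * S₁ * S₂ * f z₃ + (-2) * S₁ * (t : 𝓞 (κ.layer 2)) * f z₂ + 2 * S₁ * (t : 𝓞 (κ.layer 2)) * f z₃) * hS₂
      + ((-2) * f z₀ + 3 * f z₁ + (f q₀ ^ 2) * f e₂ + (-1) * (f q₀ ^ 2) * f e₃ + (-2) * S₂ * f z₂ + 3 * S₂ * f z₃ + (-2) * (t : 𝓞 (κ.layer 2)) * f z₂
          + 2 * (t : 𝓞 (κ.layer 2)) * f z₃ + (f q₀ ^ 2) * S₂ * f e₁ + (-2) * S₂ * (t : 𝓞 (κ.layer 2)) * f z₁ + S₂ ^ 2 * f z₀ + (-2) * S₂ ^ 2 * f z₁ + (f q₀ ^ 2) * S₂ ^ 2 * f e₃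
          + S₁ * S₂ ^ 2 * f z₁ + (-2) * S₂ ^ 2 * (t : 𝓞 (κ.layer 2)) * f z₃ + S₂ ^ 3 * f z₂ + (-2) * S₂ ^ 3 * f z₃ + S₁ * S₂ ^ 3 * f z₃) * hS₁
  have hfC2 : (f a₀ + f a₁ * S₁ + (f a₂ + f a₃ * S₁) * S₂) * b + (f c₀ + f c₁ * S₁ + (f c₂ + f c₃ * S₁) * S₂) * ((t : 𝓞 (κ.layer 2)) ^ 2 - 2 - S₁)
      + (f d₀ + f d₁ * S₁ + (f d₂ + f d₃ * S₁) * S₂) * (((t : 𝓞 (κ.layer 2)) ^ 2 + 2) - S₁ + 2 * (t : 𝓞 (κ.layer 2)) * S₂ - 2 * (t : 𝓞 (κ.layer 2)) * (S₁ * S₂)) = 1 := by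
    have g₀ := congrArg f hC2₀
    have g₁ := congrArg f hC2₁
    have g₂ := congrArg f hC2₂
    have g₃ := congrArg f hC2₃
    simp only [map_add, map_sub, map_mul, map_neg, map_pow, map_intCast, map_ofNat, map_zero, map_one] at g₀ g₁ g₂ g₃
    rw [hbf]
    linear_combination g₀ + S₁ * g₁ + S₂ * g₂ + S₁ * S₂ * g₃
      + (2 * f d₂ * (t : 𝓞 (κ.layer 2)) + (-2) * f d₂ * S₁ * (t : 𝓞 (κ.layer 2)) + 2 * f d₃ * S₁ * (t : 𝓞 (κ.layer 2))
          + (-2) * f d₃ * S₁ ^ 2 * (t : 𝓞 (κ.layer 2))) * hS₂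
      + ((-1) * f c₁ + (-1) * f d₁ + (-1) * f c₃ * S₂ + (-2) * f d₂ * (t : 𝓞 (κ.layer 2)) + (-1) * f d₃ * S₂ + (-2) * f d₃ * (t : 𝓞 (κ.layer 2))
          + (-2) * f d₁ * S₂ * (t : 𝓞 (κ.layer 2)) + (-2) * f d₃ * S₁ * (t : 𝓞 (κ.layer 2))) * hS₁
  have hPA : Ideal.span {b, (t : 𝓞 (κ.layer 2)) ^ 2 - 2 - S₁} * Ideal.span {b, ((t : 𝓞 (κ.layer 2)) ^ 2 + 2) - S₁ + 2 * (t : 𝓞 (κ.layer 2)) * S₂ - 2 * (t : 𝓞 (κ.layer 2)) * (S₁ * S₂)} =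
      Ideal.span {b, ((t : 𝓞 (κ.layer 2)) ^ 2 - 2 - S₁) * (((t : 𝓞 (κ.layer 2)) ^ 2 + 2) - S₁ + 2 * (t : 𝓞 (κ.layer 2)) * S₂ - 2 * (t : 𝓞 (κ.layer 2)) * (S₁ * S₂))} :=
    span_pair_mul_span_pair_eq_of_comax hfC2
  -- ### `y ∈ A`
  have hymem : f y₀ + f y₁ * S₁ + (f y₂ + f y₃ * S₁) * S₂ ∈
      Ideal.span {b, ((t : 𝓞 (κ.layer 2)) ^ 2 - 2 - S₁) * (((t : 𝓞 (κ.layer 2)) ^ 2 + 2) - S₁ + 2 * (t : 𝓞 (κ.layer 2)) * S₂ - 2 * (t : 𝓞 (κ.layer 2)) * (S₁ * S₂))} := by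
    rw [Ideal.mem_span_pair]
    refine ⟨f l₀ + f l₁ * S₁ + (f l₂ + f l₃ * S₁) * S₂, f m₀ + f m₁ * S₁ + (f m₂ + f m₃ * S₁) * S₂, ?_⟩
    have g₀ := congrArg f hy₀
    have g₁ := congrArg f hy₁
    have g₂ := congrArg f hy₂
    have g₃ := congrArg f hy₃
    simp only [map_add, map_sub, map_mul, map_neg, map_pow, map_intCast, map_ofNat] at g₀ g₁ g₂ g₃
    rw [hbf]
    linear_combination (-(1 : 𝓞 (κ.layer 2))) * g₀ + (-(S₁)) * g₁ + (-(S₂)) * g₂ + (-(S₁ * S₂)) * g₃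
      + ((-4) * f m₂ * (t : 𝓞 (κ.layer 2)) + 2 * f m₂ * S₁ * (t : 𝓞 (κ.layer 2)) + (-4) * f m₃ * S₁ * (t : 𝓞 (κ.layer 2))
          + 2 * f m₂ * S₁ ^ 2 * (t : 𝓞 (κ.layer 2)) + 2 * f m₂ * (t : 𝓞 (κ.layer 2)) ^ 3 + 2 * f m₃ * S₁ ^ 2 * (t : 𝓞 (κ.layer 2))
          + (-2) * f m₂ * S₁ * (t : 𝓞 (κ.layer 2)) ^ 3 + 2 * f m₃ * S₁ * (t : 𝓞 (κ.layer 2)) ^ 3 + 2 * f m₃ * S₁ ^ 3 * (t : 𝓞 (κ.layer 2))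
          + (-2) * f m₃ * S₁ ^ 2 * (t : 𝓞 (κ.layer 2)) ^ 3) * hS₂
      + (f m₀ + f m₁ * S₁ + f m₂ * S₂ + 6 * f m₂ * (t : 𝓞 (κ.layer 2)) + 4 * f m₃ * (t : 𝓞 (κ.layer 2)) + 2 * f m₀ * S₂ * (t : 𝓞 (κ.layer 2))
          + 2 * f m₁ * S₂ * (t : 𝓞 (κ.layer 2)) + (-2) * f m₁ * (t : 𝓞 (κ.layer 2)) ^ 2 + 2 * f m₂ * S₁ * (t : 𝓞 (κ.layer 2)) + f m₃ * S₁ * S₂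
          + 6 * f m₃ * S₁ * (t : 𝓞 (κ.layer 2)) + 2 * f m₁ * S₁ * S₂ * (t : 𝓞 (κ.layer 2)) + (-2) * f m₂ * (t : 𝓞 (κ.layer 2)) ^ 3
          + 2 * f m₃ * S₁ ^ 2 * (t : 𝓞 (κ.layer 2)) + (-2) * f m₃ * S₂ * (t : 𝓞 (κ.layer 2)) ^ 2 + (-2) * f m₃ * (t : 𝓞 (κ.layer 2)) ^ 3
          + (-2) * f m₁ * S₂ * (t : 𝓞 (κ.layer 2)) ^ 3 + (-2) * f m₃ * S₁ * (t : 𝓞 (κ.layer 2)) ^ 3) * hS₁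
  -- ### norms: `N(J) = (q₀)`, `N(y) = ε q₀⁴`
  have hnormq : Algebra.intNorm (𝓞 K) (𝓞 (κ.layer 2)) b = q₀ ^ 8 := by
    apply RingOfIntegers.coe_injective
    rw [Algebra.algebraMap_intNorm (A := 𝓞 K) (K := K) (L := κ.layer 2) (B := 𝓞 (κ.layer 2)) b, hbL, Algebra.norm_algebraMap, hdeg4, map_pow]
    ring
  have hnormz : Algebra.intNorm (𝓞 K) (𝓞 (κ.layer 2)) (S₂ - t) = ((t : 𝓞 K) ^ 2 - 2) ^ 2 - 2 := by
    apply RingOfIntegers.coe_injective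
    rw [Algebra.algebraMap_intNorm (A := 𝓞 K) (K := K) (L := κ.layer 2) (B := 𝓞 (κ.layer 2)) (S₂ - t), map_sub, map_intCast, hS₂val]
    have hz : (s₂ - t : κ.layer 2) = algebraMap K (κ.layer 2) (-(t : K)) + algebraMap K (κ.layer 2) 0 * algebraMap (κ.layer 1) (κ.layer 2) s₁
        + (algebraMap K (κ.layer 2) 1 + algebraMap K (κ.layer 2) 0 * algebraMap (κ.layer 1) (κ.layer 2) s₁) * s₂ := by
      simp only [map_neg, map_intCast, map_zero, map_one]; ring
    rw [hz, norm_tower2_eq hdeg1 hdeg2 hs₁ hs₁K hs₂ hs₂K (-(t : K)) 0 1 0]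
    simp only [map_sub, map_pow, map_intCast, map_ofNat]
    ring
  have hqmem : q₀ ∈ Ideal.relNorm (𝓞 K) (Ideal.span {b, S₂ - (t : 𝓞 (κ.layer 2))}) := by
    have h1 : Algebra.intNorm (𝓞 K) (𝓞 (κ.layer 2)) b ∈ Ideal.relNorm (𝓞 K) (Ideal.span {b, S₂ - (t : 𝓞 (κ.layer 2))}) :=
      Ideal.intNorm_mem_spanNorm (R := 𝓞 K) (Ideal.subset_span (by simp))
    have h2 : Algebra.intNorm (𝓞 K) (𝓞 (κ.layer 2)) (S₂ - t) ∈ Ideal.relNorm (𝓞 K) (Ideal.span {b, S₂ - (t : 𝓞 (κ.layer 2))}) :=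
      Ideal.intNorm_mem_spanNorm (R := 𝓞 K) (Ideal.subset_span (by simp))
    rw [hnormq] at h1
    rw [hnormz] at h2
    rw [← hBez]
    exact Ideal.add_mem _ (Ideal.mul_mem_left _ _ h1) (Ideal.mul_mem_left _ _ h2)
  have hψ2 : ψ (q₀ ^ 2) = 0 := by rw [map_pow, hψ, zero_pow two_ne_zero]
  have hI0top : Ideal.span {b, S₂ - (t : 𝓞 (κ.layer 2))} ≠ ⊤ := by
    rw [hb]
    exact span_pair_ne_top_of_residue_tower2 hdeg1 hdeg2 hs₁ hs₁K hs₂ hs₂K (q₀ ^ 2) t hq ψ hψ2 hti hPt hS₂val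
  have hNI₀ : Ideal.relNorm (𝓞 K) (Ideal.span {b, S₂ - (t : 𝓞 (κ.layer 2))}) = Ideal.span {q₀} := by
    have hle : Ideal.span {q₀} ≤ Ideal.relNorm (𝓞 K) (Ideal.span {b, S₂ - (t : 𝓞 (κ.layer 2))}) := (Ideal.span_singleton_le_iff_mem _).mpr hqmem
    have hne : Ideal.relNorm (𝓞 K) (Ideal.span {b, S₂ - (t : 𝓞 (κ.layer 2))}) ≠ ⊤ := fun htop => hI0top (by
      have h := Ideal.relNorm_le_comap (𝓞 K) (Ideal.span {b, S₂ - (t : 𝓞 (κ.layer 2))})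
      rw [htop, top_le_iff, Ideal.comap_eq_top_iff] at h
      exact h)
    exact (hq₀.eq_of_le hne hle).symm
  have hnormy : Algebra.intNorm (𝓞 K) (𝓞 (κ.layer 2)) (f y₀ + f y₁ * S₁ + (f y₂ + f y₃ * S₁) * S₂) = ε * q₀ ^ 4 := by
    apply RingOfIntegers.coe_injective
    rw [Algebra.algebraMap_intNorm (A := 𝓞 K) (K := K) (L := κ.layer 2) (B := 𝓞 (κ.layer 2))]
    have hz : algebraMap (𝓞 (κ.layer 2)) (κ.layer 2) (f y₀ + f y₁ * S₁ + (f y₂ + f y₃ * S₁) * S₂) =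
        algebraMap K (κ.layer 2) (y₀ : K) + algebraMap K (κ.layer 2) (y₁ : K) * algebraMap (κ.layer 1) (κ.layer 2) s₁
        + (algebraMap K (κ.layer 2) (y₂ : K) + algebraMap K (κ.layer 2) (y₃ : K) * algebraMap (κ.layer 1) (κ.layer 2) s₁) * s₂ := by
      simp only [map_add, map_mul, hcoe, hS₁val, hS₂val]
    have gN := congrArg (algebraMap (𝓞 K) K) hN
    simp only [map_add, map_sub, map_mul, map_pow, map_ofNat] at gN
    rw [hz, norm_tower2_eq hdeg1 hdeg2 hs₁ hs₁K hs₂ hs₂K]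
    exact gN
  -- ### `(y) = A`
  have hconj : ∀ τ : (κ.layer 2) ≃ₐ[K] (κ.layer 2),
      Ideal.relNorm (𝓞 K) ((Ideal.span {b, S₂ - (t : 𝓞 (κ.layer 2))}).map (intAut τ : 𝓞 (κ.layer 2) →+* 𝓞 (κ.layer 2))) = Ideal.span {q₀} := by
    intro τ
    have hpt : ∀ x : 𝓞 (κ.layer 2), (intAut τ : 𝓞 (κ.layer 2) →+* 𝓞 (κ.layer 2)) x = galRestrict (𝓞 K) K (κ.layer 2) (𝓞 (κ.layer 2)) τ x := by
      intro x
      apply RingOfIntegers.coe_injective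
      rw [hia, algebraMap_galRestrict_apply]
    have hm : (Ideal.span {b, S₂ - (t : 𝓞 (κ.layer 2))}).map (intAut τ : 𝓞 (κ.layer 2) →+* 𝓞 (κ.layer 2)) =
        (Ideal.span {b, S₂ - (t : 𝓞 (κ.layer 2))}).map (galRestrict (𝓞 K) K (κ.layer 2) (𝓞 (κ.layer 2)) τ) := by
      unfold Ideal.map
      congr 1
      ext z
      simp only [Set.mem_image, SetLike.mem_coe, hpt]
    rw [hm, Ideal.relNorm_map_algEquiv, hNI₀]
  have hrelNormA : Ideal.relNorm (𝓞 K) (Ideal.span {b, ((t : 𝓞 (κ.layer 2)) ^ 2 - 2 - S₁) *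
      (((t : 𝓞 (κ.layer 2)) ^ 2 + 2) - S₁ + 2 * (t : 𝓞 (κ.layer 2)) * S₂ - 2 * (t : 𝓞 (κ.layer 2)) * (S₁ * S₂))}) = Ideal.span {q₀} ^ 4 := by
    rw [← hPA, ← hP02, ← hsq, map_mul, map_mul, map_pow, ← hmapI 1 _ hZ₀, ← hmapI σ _ hZ₁, ← hmapI (σ ^ 2) _ hZ₂, hconj, hconj, hconj]
    ring
  have hyA : Ideal.span {f y₀ + f y₁ * S₁ + (f y₂ + f y₃ * S₁) * S₂} = Ideal.span {b, ((t : 𝓞 (κ.layer 2)) ^ 2 - 2 - S₁) *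
      (((t : 𝓞 (κ.layer 2)) ^ 2 + 2) - S₁ + 2 * (t : 𝓞 (κ.layer 2)) * S₂ - 2 * (t : 𝓞 (κ.layer 2)) * (S₁ * S₂))} := by
    have hle := (Ideal.span_singleton_le_iff_mem _).mpr hymem
    obtain ⟨C, hC⟩ := Ideal.dvd_iff_le.mpr hle
    have hNy : Ideal.relNorm (𝓞 K) (Ideal.span {f y₀ + f y₁ * S₁ + (f y₂ + f y₃ * S₁) * S₂}) = Ideal.span {q₀} ^ 4 := by
      rw [Ideal.relNorm_singleton, hnormy, Ideal.span_singleton_pow]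
      exact Ideal.span_singleton_eq_span_singleton.mpr ⟨ε⁻¹, by simp [mul_comm]⟩
    have hne : Ideal.span {q₀} ^ 4 ≠ 0 := pow_ne_zero _ (by rw [Ne, Ideal.zero_eq_bot, Ideal.span_singleton_eq_bot]; exact hq₀0)
    have hNC : Ideal.relNorm (𝓞 K) C = ⊤ := by
      have h := congrArg (Ideal.relNorm (𝓞 K)) hC
      rw [map_mul, hNy, hrelNormA] at h
      have h' : Ideal.span {q₀} ^ 4 * Ideal.relNorm (𝓞 K) C = Ideal.span {q₀} ^ 4 * ⊤ := by rw [Ideal.mul_top]; exact h.symm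
      exact mul_left_cancel₀ hne h'
    have hCtop : C = ⊤ := by
      by_contra hC'
      obtain ⟨M, hM, hCM⟩ := Ideal.exists_le_maximal C hC'
      have h := Ideal.relNorm_mono (𝓞 K) hCM
      rw [hNC, top_le_iff] at h
      haveI := hM
      haveI : (M.under (𝓞 K)).IsMaximal := Ideal.IsMaximal.under (𝓞 K) M
      rw [Ideal.relNorm_eq_pow_of_isMaximal M (M.under (𝓞 K)), Ideal.pow_eq_top_iff] at h
      rcases h with h | h
      · exact (Ideal.IsMaximal.ne_top inferInstance) h
      · exact (Ideal.inertiaDeg_pos M (R := 𝓞 K)).ne' h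
    rw [hC, hCtop, Ideal.mul_top]
  -- ### the relation `J·(σJ)²·σ²J = (y)` and the door
  have hprod : ∏ i ∈ range 3, ((Ideal.span {b, S₂ - (t : 𝓞 (κ.layer 2))}).map (intAut (σ ^ i) : 𝓞 (κ.layer 2) →+* 𝓞 (κ.layer 2))) ^
        (fun i : ℕ => if i = 1 then 2 else 1) i =
      Ideal.span {f y₀ + f y₁ * S₁ + (f y₂ + f y₃ * S₁) * S₂} := by
    simp only [Finset.prod_range_succ, Finset.prod_range_zero, one_mul]
    norm_num
    rw [hmapI 1 _ hZ₀, hmapI σ _ hZ₁, hmapI (σ ^ 2) _ hZ₂, hyA, ← hPA, ← hP02, ← hsq]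
    ring
  have hrel := prod_pow_mulEquiv_intAut_mk0_eq_one (F := K) σ hI0 hprod
  have hA0 : Ideal.relNorm (𝓞 (κ.layer 1)) (Ideal.span {b, S₂ - (t : 𝓞 (κ.layer 2))}) ≠ ⊥ :=
    (Ideal.relNorm_eq_bot_iff (R := 𝓞 (κ.layer 1))).not.mpr hI0
  have hA : Ideal.relNorm (𝓞 K) (Ideal.relNorm (𝓞 (κ.layer 1)) (Ideal.span {b, S₂ - (t : 𝓞 (κ.layer 2))})) ^ 1 = Ideal.span {q₀} := by
    rw [pow_one, Ideal.relNorm_relNorm, hNI₀]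
  have hcA : classGroupNorm (κ.layer 1) (κ.layer 2) (ClassGroup.mk0 ⟨Ideal.span {b, S₂ - (t : 𝓞 (κ.layer 2))}, mem_nonZeroDivisors_of_ne_zero hI0⟩) =
      ClassGroup.mk0 ⟨Ideal.relNorm (𝓞 (κ.layer 1)) (Ideal.span {b, S₂ - (t : 𝓞 (κ.layer 2))}), mem_nonZeroDivisors_of_ne_zero hA0⟩ :=
    classGroupNorm_mk0 (κ.layer 1) ⟨_, mem_nonZeroDivisors_of_ne_zero hI0⟩
  have hF : (∑ i ∈ range 3, C (((fun i : ℕ => if i = 1 then 2 else 1) i : ℕ) : ℤ) * X ^ i : ℤ[X]) = (X - 1) ^ 2 * 1 + C (2 : ℤ) * (2 * X) := by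
    simp only [Finset.sum_range_succ, Finset.sum_range_zero, zero_add]
    norm_num
    ring
  have hu : ¬ (2 : ℤ) ∣ (1 : ℤ[X]).eval 1 := by norm_num
  exact classicalMuVanishes_two_of_relation_of_genusCert_layer_anyDepth hK2 hd κ hκ h2card hh (m := 2) (by norm_num) P hres h2P hunits hπ hA0 hA σ hgen
    hcA (N := 3) (d := 2) (by norm_num) hu hF hrel

end Literature.NumberTheory.IwasawaTheory

end
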